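import Summits.Ventures.CertifiedQuantumChemistry.Rows.HubbardRingKernel
import Literature.MathematicalPhysics.QuantumLattice.StrongCouplingSecondOrderLimit
import Literature.MathematicalPhysics.QuantumLattice.HubbardAtomicLimit
import HarnessLib

/-!
# Ventures/CertifiedQuantumChemistry — Rows/HubbardHalfFilledStrongCoupling.lean: the half-filled sector of a
# graph Hubbard model meets the hypotheses of Kato's second-order reduction (sub-row T-K0-4, part 1 of 2)

HONEST FRAMING (verbatim): certified bounds for a stated model Hamiltonian in a stated basis; not a
claim about the real molecule beyond that model.

Seat ref/typer (`pub-qchem-typer`, gen 19), sub-row T-K0-4 (the lead's word HOME/INBOX L785 (D), RULINGS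
TYP-46), part 1 (generic graph); part 2 = `Rows/HubbardRingStrongCouplingLimit.lean` (the 4-ring constant
`−12`). THEOREMS ONLY (no `def`, no claim node, no row), zero compute, standard axioms; NOT a row, scores
nothing, moves no `CERTIFIED.md` byte.

## What is proved (any finite graph `G`, hopping `t`, sector `(N↑, N↓) = (a, b)`)

* §1 the PENCIL form of the tree's graph Hubbard Hamiltonian,
  `hamiltonian G t U = hamiltonian G t 0 + U · diagonal (s ↦ #doublyOccupied s)`
  (`hamiltonian_eq_add_smul_diagonal`; the interaction `Σ_x n_{x↑} n_{x↓}` is the diagonal DOUBLON COUNT —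
  the tree's `HubbardAtomicLimit.sum_numberOp_mul_numberOp_eq_diagonal` / `doublyOccupied`).
* §2 at HALF FILLING `a + b = |Λ|`, the hypotheses of Kato's second-order reduction with vanishing
  first-order term (`Literature/MathematicalPhysics/QuantumLattice/StrongCouplingSecondOrderLimit.lean`,
  Kato 1966 Ch. II §2.3): the joint sector `szSector (a+b) ((a−b)/2)` is the COORDINATE sector of the
  `(a, b)` configurations (`mem_szSector_iff_apply_eq_zero`); the degenerate set `Z` = `(a, b)`
  configurations with NO doubly occupied site, on which (pigeonhole at half filling,
  `singly_of_halfFilled`) every site is singly occupied; VANISHING FIRST-ORDER TERM `P A P = 0` — no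
  hopping term connects two singly occupied configurations (`hamiltonian_zero_apply_eq_zero_of_singly`);
  GAP `δ = 1` with a SCALAR reduced resolvent on the first-order range — a configuration one hop away
  from a singly occupied one has EXACTLY ONE doublon
  (`card_doublyOccupied_eq_one_of_hamiltonian_zero_apply_ne_zero`). Assembled:
  **`tendsto_mul_minEnergyOn_hamiltonian_halfFilled`** —
  `U · E_{(a,b)}(hamiltonian G t U) → E_{K₀}(−(hamiltonian G t 0)²)` as `U → ∞` (real `U`), where `K₀` is
  the coordinate subspace of the singly occupied `(a, b)` configurations, entering only through its
  membership characterisation (e.g. Mathlib's `Submodule.pi (↑Z)ᶜ ⊥`, `mem_pi_compl_bot_iff`). This is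
  the second-order (superexchange) effective description of the half-filled Hubbard model, Takahashi
  1999 §6.4 (6.96)–(6.98), up to the identification of `−P A² P` with a Heisenberg model, which is NOT
  made here.

References: T. Kato, *Perturbation Theory for Linear Operators* (1966) Ch. II §2.3 [Kato1966];
M. Takahashi, *Thermodynamics of One-Dimensional Solvable Models* (1999) §6.4 [Takahashi1999];
E. H. Lieb, PRL 62 (1989) 1201 (sectors, Remark (2)) [LiebPRL1989]. Tree (REUSED):
`tendsto_mul_minEnergyOn_pencil`, `mem_szSector_iff_isInSector`, `LiebThm1.preservesSectors_hamiltonian`,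
`LiebTwo.creation_mul_annihilation_apply_ne_zero`, `doublyOccupied` / `sum_numberOp_mul_numberOp_eq_diagonal`
(`HubbardAtomicLimit`), `hamiltonian_isHermitian_and_commute_holds`; Mathlib `Submodule.pi`,
`Finset.eq_univ_of_card`. Typer `pub-qchem-typer` (gen 19), 0 core-h.
-/

noncomputable section

namespace Summit.Ventures.CertifiedQuantumChemistry

open Matrix Finset Filter Topology
open Literature.MathematicalPhysics.QuantumLattice Literature.MathematicalPhysics.QuantumChemistry
open Literature.MathematicalPhysics.QuantumLattice.TwoSpecies LiebThm1
open Summit.Ventures.CertifiedQuantumChemistry.Hamiltonians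

/-! ## §1 The pencil decomposition `H(t, U) = H(t, 0) + U · diag(number of doubly occupied sites)` -/

section Pencil

variable {Λ : Type*} [LinearOrder Λ] [Fintype Λ]

variable (G : SimpleGraph Λ) [DecidableRel G.Adj]

/-- **The Hubbard Hamiltonian as a Hermitian pencil in `U`:**
`H(t, U) = H(t, 0) + U · diag (number of doubly occupied sites)`. -/
theorem hamiltonian_eq_add_smul_diagonal (t U : ℝ) :
    hamiltonian G t U = hamiltonian G t 0 +
      (U : ℂ) • diagonal (fun s => ((((doublyOccupied s).card : ℕ) : ℝ) : ℂ)) := by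
  simp only [hamiltonian, Complex.ofReal_zero, zero_smul, add_zero, sum_numberOp_mul_numberOp_eq_diagonal,
    Complex.ofReal_natCast]

/-- The `U = 0` Hamiltonian (pure hopping) is Hermitian. -/
theorem hamiltonian_zero_isHermitian (t : ℝ) : (hamiltonian G t 0).IsHermitian :=
  (hamiltonian_isHermitian_and_commute_holds G t 0).1

end Pencil

/-! ## §2 The half-filled sector of a graph Hubbard model satisfies the hypotheses of Kato's
second-order reduction: degenerate set = singly occupied configurations, `P A P = 0`, unit gap -/

section HalfFilling

variable {Λ : Type*} [LinearOrder Λ] [Fintype Λ]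

/-- The joint sector `(N, S^z) = (a + b, (a − b)/2)` is the COORDINATE sector of the configurations with
`a` up and `b` down electrons (restates `mem_szSector_iff_isInSector`). -/
theorem mem_szSector_iff_apply_eq_zero (a b : ℕ) (ψ : Fock (Orb Λ)) :
    ψ ∈ szSector (a + b) (((a : ℝ) - b) / 2) ↔
      ∀ s ∉ (univ.filter fun s : Finset (Orb Λ) => (upPart s).card = a ∧ (downPart s).card = b),
        ψ s = 0 := by
  rw [mem_szSector_iff_isInSector]
  simp only [IsInSector, Finset.mem_filter, Finset.mem_univ, true_and]

/-- The coordinate subspace on a set `Z` of basis configurations, written with Mathlib's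
`Submodule.pi` (no new definition): `ψ ∈ pi (↑Z)ᶜ ⊥ ↔ ψ = 0` off `Z`. -/
theorem mem_pi_compl_bot_iff {ι : Type*} (Z : Finset ι) (ψ : ι → ℂ) :
    ψ ∈ Submodule.pi ((Z : Set ι)ᶜ) (fun _ => (⊥ : Submodule ℂ ℂ)) ↔ ∀ i ∉ Z, ψ i = 0 := by
  rw [Submodule.mem_pi]
  simp only [Set.mem_compl_iff, Finset.mem_coe, Submodule.mem_bot]

omit [Fintype Λ] in
/-- In a configuration where every site is SINGLY occupied (`x↑ ∈ s ↔ x↓ ∉ s`), an absent spin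
orbital at a site means the opposite one is present. -/
theorem mem_of_not_mem_of_singly {s : Finset (Orb Λ)} (hs : ∀ z : Λ, orb z 0 ∈ s ↔ orb z 1 ∉ s)
    {z : Λ} {σ τ : Fin 2} (hστ : σ ≠ τ) (h : orb z σ ∉ s) : orb z τ ∈ s := by
  have h' := hs z
  fin_cases σ <;> fin_cases τ
  · exact absurd rfl hστ
  · by_contra h1
    exact h (h'.2 h1)
  · exact h'.2 h
  · exact absurd rfl hστ

omit [LinearOrder Λ] [Fintype Λ] in
/-- In a singly occupied configuration two spin orbitals of the same site are never both present. -/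
theorem not_mem_of_mem_of_singly {s : Finset (Orb Λ)} (hs : ∀ z : Λ, orb z 0 ∈ s ↔ orb z 1 ∉ s)
    {z : Λ} {σ τ : Fin 2} (hστ : σ ≠ τ) (h : orb z σ ∈ s) : orb z τ ∉ s := by
  have h' := hs z
  fin_cases σ <;> fin_cases τ
  · exact absurd rfl hστ
  · exact h'.1 h
  · intro h0
    exact h'.1 h0 h
  · exact absurd rfl hστ

/-- **At half filling, no doubly occupied site means every site singly occupied**: if
`#↑(s) + #↓(s) = |Λ|` and `↑(s) ∩ ↓(s) = ∅` then `x↑ ∈ s ↔ x↓ ∉ s` for every site `x`. -/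
theorem singly_of_halfFilled {s : Finset (Orb Λ)}
    (hN : (upPart s).card + (downPart s).card = Fintype.card Λ)
    (hd : (doublyOccupied s).card = 0) (z : Λ) : orb z 0 ∈ s ↔ orb z 1 ∉ s := by
  rw [Finset.card_eq_zero, doublyOccupied] at hd
  have hdisj : Disjoint (upPart s) (downPart s) := Finset.disjoint_iff_inter_eq_empty.2 hd
  have hunion : upPart s ∪ downPart s = univ := by
    apply Finset.eq_univ_of_card
    rw [Finset.card_union_of_disjoint hdisj, hN]
  have hz : z ∈ upPart s ∪ downPart s := hunion ▸ Finset.mem_univ z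
  rw [Finset.mem_union, mem_upPart, mem_downPart] at hz
  constructor
  · intro h0 h1
    have hmem : z ∈ upPart s ∩ downPart s :=
      Finset.mem_inter.2 ⟨(mem_upPart s z).2 h0, (mem_downPart s z).2 h1⟩
    rw [hd] at hmem
    exact Finset.notMem_empty z hmem
  · intro h1
    exact hz.resolve_right h1

variable (G : SimpleGraph Λ) [DecidableRel G.Adj]

/-- A nonzero entry of the pure-hopping Hamiltonian `H(t, 0)` comes from one hopping term
`c†_{xσ} c_{yσ}` along an edge `x ∼ y`. -/
theorem exists_adj_of_hamiltonian_zero_apply_ne_zero (t : ℝ) {s u : Finset (Orb Λ)}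
    (h : hamiltonian G t 0 s u ≠ 0) :
    ∃ x y : Λ, ∃ σ : Fin 2, G.Adj x y ∧
      (creation (orb x σ) * annihilation (orb y σ) : Matrix (Finset (Orb Λ)) (Finset (Orb Λ)) ℂ) s u ≠ 0 := by
  unfold hamiltonian at h
  rw [Complex.ofReal_zero, zero_smul, add_zero, Matrix.smul_apply, Matrix.sum_apply, smul_eq_mul] at h
  obtain ⟨x, -, hx⟩ := Finset.exists_ne_zero_of_sum_ne_zero (right_ne_zero_of_mul h)
  rw [Matrix.sum_apply] at hx
  obtain ⟨y, -, hy⟩ := Finset.exists_ne_zero_of_sum_ne_zero hx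
  rw [Matrix.sum_apply] at hy
  obtain ⟨σ, -, hσ⟩ := Finset.exists_ne_zero_of_sum_ne_zero hy
  by_cases hadj : G.Adj x y
  · rw [if_pos hadj] at hσ
    exact ⟨x, y, σ, hadj, hσ⟩
  · rw [if_neg hadj] at hσ
    exact absurd rfl hσ

/-- **Vanishing first-order term `P A P = 0` at half filling**: a hopping term has no matrix element
between two singly occupied configurations (the hop necessarily creates a doubly occupied site). -/
theorem hop_apply_eq_zero_of_singly {x y : Λ} (hxy : x ≠ y) (σ : Fin 2) {s u : Finset (Orb Λ)}
    (hs : ∀ z : Λ, orb z 0 ∈ s ↔ orb z 1 ∉ s) (hu : ∀ z : Λ, orb z 0 ∈ u ↔ orb z 1 ∉ u) :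
    (creation (orb x σ) * annihilation (orb y σ) : Matrix (Finset (Orb Λ)) (Finset (Orb Λ)) ℂ) s u = 0 := by
  by_contra h
  obtain ⟨hx, hy, rfl⟩ := LiebTwo.creation_mul_annihilation_apply_ne_zero h
  obtain ⟨τ, hστ⟩ : ∃ τ : Fin 2, σ ≠ τ := ⟨σ + 1, by fin_cases σ <;> decide⟩
  have hyx : orb y σ ≠ orb x σ := fun e => hxy (orb_inj.1 e).1.symm
  have hyσ : orb y σ ∉ s := fun hmem => hy (Finset.mem_erase.2 ⟨hyx, hmem⟩)
  have hyτ : orb y τ ∈ s := mem_of_not_mem_of_singly hs hστ hyσ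
  have hyτu : orb y τ ∈ insert (orb y σ) (s.erase (orb x σ)) :=
    Finset.mem_insert_of_mem (Finset.mem_erase.2 ⟨fun e => hxy (orb_inj.1 e).1.symm, hyτ⟩)
  exact not_mem_of_mem_of_singly hu hστ (Finset.mem_insert_self _ _) hyτu

/-- `P A P = 0` for the whole hopping Hamiltonian between singly occupied configurations. -/
theorem hamiltonian_zero_apply_eq_zero_of_singly (t : ℝ) {s u : Finset (Orb Λ)}
    (hs : ∀ z : Λ, orb z 0 ∈ s ↔ orb z 1 ∉ s) (hu : ∀ z : Λ, orb z 0 ∈ u ↔ orb z 1 ∉ u) :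
    hamiltonian G t 0 s u = 0 := by
  by_contra h
  obtain ⟨x, y, σ, hadj, hne⟩ := exists_adj_of_hamiltonian_zero_apply_ne_zero G t h
  exact hne (hop_apply_eq_zero_of_singly (G.ne_of_adj hadj) σ hs hu)

/-- **Unit excitation gap on the first-order range**: a configuration `s` connected by one hopping term
to a singly occupied configuration `u` has EXACTLY ONE doubly occupied site. -/
theorem card_doublyOccupied_eq_one_of_hop_apply_ne_zero {x y : Λ} (hxy : x ≠ y) {σ : Fin 2}
    {s u : Finset (Orb Λ)} (hu : ∀ z : Λ, orb z 0 ∈ u ↔ orb z 1 ∉ u)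
    (h : (creation (orb x σ) * annihilation (orb y σ) : Matrix (Finset (Orb Λ)) (Finset (Orb Λ)) ℂ) s u ≠ 0) :
    (doublyOccupied s).card = 1 := by
  obtain ⟨hx, hy, rfl⟩ := LiebTwo.creation_mul_annihilation_apply_ne_zero h
  obtain ⟨τ, hστ⟩ : ∃ τ : Fin 2, σ ≠ τ := ⟨σ + 1, by fin_cases σ <;> decide⟩
  have hyx : orb y σ ≠ orb x σ := fun e => hxy (orb_inj.1 e).1.symm
  have hyσ : orb y σ ∉ s := fun hmem => hy (Finset.mem_erase.2 ⟨hyx, hmem⟩)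
  -- membership in `u = insert y_σ (s ∖ x_σ)` for orbitals other than `x_σ`, `y_σ`
  have htrans : ∀ o : Orb Λ, o ≠ orb x σ → o ≠ orb y σ →
      (o ∈ insert (orb y σ) (s.erase (orb x σ)) ↔ o ∈ s) := by
    intro o hox hoy
    rw [Finset.mem_insert, Finset.mem_erase]
    constructor
    · rintro (e | ⟨-, ho⟩)
      · exact absurd e hoy
      · exact ho
    · exact fun ho => Or.inr ⟨hox, ho⟩
  -- `x_σ ∉ u`, hence `x_τ ∈ u`, hence `x_τ ∈ s`
  have hxσu : orb x σ ∉ insert (orb y σ) (s.erase (orb x σ)) := by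
    rw [Finset.mem_insert, Finset.mem_erase]
    rintro (e | ⟨hne, -⟩)
    · exact hyx e.symm
    · exact hne rfl
  have hxτu : orb x τ ∈ insert (orb y σ) (s.erase (orb x σ)) := mem_of_not_mem_of_singly hu hστ hxσu
  have hxτ : orb x τ ∈ s :=
    (htrans (orb x τ) (fun e => hστ (orb_inj.1 e).2.symm) (fun e => hxy (orb_inj.1 e).1)).1 hxτu
  -- the doubly occupied sites of `s` are exactly `{x}`
  have hboth : ∀ ρ : Fin 2, orb x ρ ∈ s := by
    intro ρ
    by_cases hρ : ρ = σ
    · rw [hρ]; exact hx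
    · have : ρ = τ := by
        fin_cases σ <;> fin_cases τ <;> fin_cases ρ <;> simp_all
      rw [this]; exact hxτ
  rw [Finset.card_eq_one]
  refine ⟨x, Finset.eq_singleton_iff_unique_mem.2 ⟨?_, fun z hz => ?_⟩⟩
  · rw [mem_doublyOccupied]
    exact ⟨hboth 0, hboth 1⟩
  · rw [mem_doublyOccupied] at hz
    by_contra hzx
    by_cases hzy : z = y
    · subst hzy
      fin_cases σ
      · exact hyσ hz.1
      · exact hyσ hz.2
    · have h0 := (htrans (orb z 0) (fun e => hzx (orb_inj.1 e).1) (fun e => hzy (orb_inj.1 e).1)).2 hz.1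
      have h1 := (htrans (orb z 1) (fun e => hzx (orb_inj.1 e).1) (fun e => hzy (orb_inj.1 e).1)).2 hz.2
      exact (hu z).1 h0 h1

/-- The same for the whole hopping Hamiltonian: `H(t,0) s u ≠ 0` with `u` singly occupied forces exactly
one doubly occupied site in `s`. -/
theorem card_doublyOccupied_eq_one_of_hamiltonian_zero_apply_ne_zero (t : ℝ) {s u : Finset (Orb Λ)}
    (hu : ∀ z : Λ, orb z 0 ∈ u ↔ orb z 1 ∉ u) (h : hamiltonian G t 0 s u ≠ 0) :
    (doublyOccupied s).card = 1 := by
  obtain ⟨x, y, σ, hadj, hne⟩ := exists_adj_of_hamiltonian_zero_apply_ne_zero G t h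
  exact card_doublyOccupied_eq_one_of_hop_apply_ne_zero (G.ne_of_adj hadj) hu hne

/-- **The strong-coupling (second-order) limit of a half-filled Hubbard sector on a finite graph**:
`U · E₀(H(t,U); N↑ = a, N↓ = b) → E_{K₀}(−H(t,0)²)` as `U → ∞` when `a + b = |Λ|`, where `K₀` is the
coordinate subspace of the singly occupied `(a, b)` configurations (Kato's reduction with vanishing
first-order term, `Literature…StrongCouplingSecondOrderLimit`, instantiated: degenerate set = no doubly
occupied site, gap `δ = 1`, `P A P = 0`, one hop out of `K₀` creates exactly one doublon). `K₀` enters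
through its membership characterisation only. -/
theorem tendsto_mul_minEnergyOn_hamiltonian_halfFilled (t : ℝ) {a b : ℕ} (hab : a + b = Fintype.card Λ)
    {K₀ : Submodule ℂ (Fock (Orb Λ))}
    (hK₀ : ∀ ψ, ψ ∈ K₀ ↔ ∀ s : Finset (Orb Λ),
      ¬(((upPart s).card = a ∧ (downPart s).card = b) ∧ (doublyOccupied s).card = 0) → ψ s = 0)
    (hne : ∃ s : Finset (Orb Λ),
      ((upPart s).card = a ∧ (downPart s).card = b) ∧ (doublyOccupied s).card = 0) :
    Tendsto (fun U : ℝ => U * (hamiltonian G t U).minEnergyOn (szSector (a + b) (((a : ℝ) - b) / 2)))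
      atTop (𝓝 ((-(hamiltonian G t 0 * hamiltonian G t 0)).minEnergyOn K₀)) := by
  classical
  set σ : Finset (Finset (Orb Λ)) :=
    univ.filter fun s => (upPart s).card = a ∧ (downPart s).card = b with hσdef
  set Z : Finset (Finset (Orb Λ)) := univ.filter fun s =>
    ((upPart s).card = a ∧ (downPart s).card = b) ∧ (doublyOccupied s).card = 0 with hZdef
  have hmemσ : ∀ s, s ∈ σ ↔ (upPart s).card = a ∧ (downPart s).card = b := fun s => by
    rw [hσdef, Finset.mem_filter]; simp only [Finset.mem_univ, true_and]
  have hmemZ : ∀ s, s ∈ Z ↔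
      ((upPart s).card = a ∧ (downPart s).card = b) ∧ (doublyOccupied s).card = 0 := fun s => by
    rw [hZdef, Finset.mem_filter]; simp only [Finset.mem_univ, true_and]
  -- singly occupied on `Z`
  have hZsingly : ∀ u ∈ Z, ∀ z : Λ, orb z 0 ∈ u ↔ orb z 1 ∉ u := by
    intro u hu
    obtain ⟨⟨h1, h2⟩, h3⟩ := (hmemZ u).1 hu
    exact singly_of_halfFilled (by rw [h1, h2, hab]) h3
  have hA := hamiltonian_zero_isHermitian G t
  have hK : ∀ ψ : Fock (Orb Λ), ψ ∈ szSector (a + b) (((a : ℝ) - b) / 2) ↔ ∀ s ∉ σ, ψ s = 0 :=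
    mem_szSector_iff_apply_eq_zero a b
  have hK₀' : ∀ ψ : Fock (Orb Λ), ψ ∈ K₀ ↔ ∀ s ∉ Z, ψ s = 0 := by
    intro ψ
    rw [hK₀ ψ]
    simp only [hmemZ]
  have hZσ : Z ⊆ σ := fun s hs => (hmemσ s).2 ((hmemZ s).1 hs).1
  have hK₀ne : K₀ ≠ ⊥ := by
    obtain ⟨s, hs⟩ := hne
    rw [Submodule.ne_bot_iff]
    refine ⟨Pi.single s 1, (hK₀' _).2 fun i hi => ?_, ?_⟩
    · rw [Pi.single_apply, if_neg]
      rintro rfl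
      exact hi ((hmemZ _).2 hs)
    · intro h
      have := congrFun h s
      rw [Pi.single_eq_same, Pi.zero_apply] at this
      exact one_ne_zero this
  have hAσ : ∀ i ∉ σ, ∀ j ∈ σ, hamiltonian G t 0 i j = 0 := by
    intro i hi j hj
    by_contra h
    have hp := preservesSectors_hamiltonian G t 0 i j h
    rw [hmemσ] at hi hj
    exact hi ⟨hp.1.trans hj.1, hp.2.trans hj.2⟩
  have hAZ : ∀ i ∈ Z, ∀ j ∈ Z, hamiltonian G t 0 i j = 0 := fun i hi j hj =>
    hamiltonian_zero_apply_eq_zero_of_singly G t (hZsingly i hi) (hZsingly j hj)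
  have hd0 : ∀ i ∈ Z, (((doublyOccupied i).card : ℕ) : ℝ) = 0 := fun i hi => by
    rw [((hmemZ i).1 hi).2, Nat.cast_zero]
  have hdδ : ∀ i ∈ σ, i ∉ Z → (1 : ℝ) ≤ (((doublyOccupied i).card : ℕ) : ℝ) := by
    intro i hi hiZ
    have hne0 : (doublyOccupied i).card ≠ 0 := fun h0 =>
      hiZ ((hmemZ i).2 ⟨(hmemσ i).1 hi, h0⟩)
    exact_mod_cast Nat.one_le_iff_ne_zero.2 hne0
  have hexc : ∀ i ∉ Z, (∃ j ∈ Z, hamiltonian G t 0 i j ≠ 0) →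
      (((doublyOccupied i).card : ℕ) : ℝ) = 1 := by
    rintro i - ⟨j, hj, hij⟩
    rw [card_doublyOccupied_eq_one_of_hamiltonian_zero_apply_ne_zero G t (hZsingly j hj) hij, Nat.cast_one]
  have hlim := tendsto_mul_minEnergyOn_pencil hA (fun s => (((doublyOccupied s).card : ℕ) : ℝ))
    hK hK₀' hZσ hK₀ne hAσ hAZ hd0 one_pos hdδ hexc
  rw [div_one] at hlim
  refine hlim.congr fun U => ?_
  rw [← hamiltonian_eq_add_smul_diagonal]

end HalfFilling

end Summit.Ventures.CertifiedQuantumChemistry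

end
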